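import Mathlib
import Summits.CriticalPhenomena.SAWScalingLimit.Theses.SAWLeftRightFKG
import Summits.CriticalPhenomena.SAWScalingLimit.Theorems.SAWLeftRightFKGLeftRightFKGReduction
import Summits.CriticalPhenomena.SAWScalingLimit.Theorems.SAWLeftRightFKGLeftRightFKGTP2Defs
import Summits.CriticalPhenomena.SAWScalingLimit.Theorems.SAWLeftRightFKGLeftRightFKGStubClassDictionary
import Summits.CriticalPhenomena.SAWScalingLimit.Theorems.SAWLeftRightFKGLeftRightFKGStubAllMeetProportional
import Summits.CriticalPhenomena.SAWScalingLimit.Theorems.SAWLeftRightFKGLeftRightFKGStubCornerAssembly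
import Summits.CriticalPhenomena.SAWScalingLimit.Theorems.SAWTotalPositivityBoundaryTP2Defs
import Summits.CriticalPhenomena.SAWScalingLimit.Theorems.SAWTotalPositivityBoundaryTP2Kernel
import Summits.CriticalPhenomena.SAWScalingLimit.Theorems.SAWTotalPositivityBoundaryTP2Symmetry
import Summits.CriticalPhenomena.SAWScalingLimit.Theorems.SAWLeftRightFKGLeftRightFKGOfInterlacedTP2
import Summits.CriticalPhenomena.SAWScalingLimit.Theorems.SAWLeftRightFKGLeftRightFKGStubVisitDeg2
import Summits.CriticalPhenomena.SAWScalingLimit.Theorems.SAWLeftRightFKGLeftRightFKGStubSquareLeOne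
import Summits.CriticalPhenomena.SAWScalingLimit.Theorems.SAWLeftRightFKGLeftRightFKGStubChainGadget
import Summits.CriticalPhenomena.SAWScalingLimit.Theorems.SAWLeftRightFKGLeftRightFKGStubTwoChainThreePoint
import Summits.CriticalPhenomena.SAWScalingLimit.Theorems.SAWLeftRightFKGLeftRightFKGStubBlobGadget
import Summits.CriticalPhenomena.SAWScalingLimit.Theorems.SAWLeftRightFKGLeftRightFKGStubCornerQuadrupleOfGraphTP2
import Summits.CriticalPhenomena.SAWScalingLimit.Theorems.LeftRightFKG.Negative.RectMesh
import Summits.CriticalPhenomena.SAWScalingLimit.Theorems.LeftRightFKG.Negative.OrderCharacterisation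
import Summits.CriticalPhenomena.SAWScalingLimit.Theorems.SAWLeftRightFKGLeftRightFKGRectBoundaryWalk
import Summits.CriticalPhenomena.SAWScalingLimit.Theorems.SAWLeftRightFKGLeftRightFKGFirstStepMonotone
import Summits.CriticalPhenomena.SAWScalingLimit.Theorems.SAWLeftRightFKGLeftRightFKGFKGTransfer
import Summits.CriticalPhenomena.SAWScalingLimit.Theorems.SAWLeftRightFKGLeftRightFKGLadderStructure
import Summits.CriticalPhenomena.SAWScalingLimit.Theorems.SAWLeftRightFKGLeftRightFKGLadderChords
import Summits.CriticalPhenomena.SAWScalingLimit.Theorems.SAWLeftRightFKGLeftRightFKGBoxLeafThreePoint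
import Summits.CriticalPhenomena.SAWScalingLimit.Theorems.SAWLeftRightFKGLeftRightFKGBoxCornerMinor
import Summits.CriticalPhenomena.SAWScalingLimit.Theorems.SAWLeftRightFKGLeftRightFKGNotchedBoxWalk
import Summits.CriticalPhenomena.SAWScalingLimit.Theorems.SAWLeftRightFKGLeftRightFKGNotchThreePoint
import Summits.CriticalPhenomena.SAWScalingLimit.Theorems.SAWLeftRightFKGLeftRightFKGNotchUpClosed
import Summits.CriticalPhenomena.SAWScalingLimit.Theorems.SAWLeftRightFKGLeftRightFKGNotchThreePointOfPA
import Summits.CriticalPhenomena.SAWScalingLimit.Theorems.SAWLeftRightFKGLeftRightFKGNotch54Cert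
import Summits.CriticalPhenomena.SAWScalingLimit.Theorems.SAWLeftRightFKGLeftRightFKGCornerMinorOfIneq
import Summits.CriticalPhenomena.SAWScalingLimit.Theorems.SAWLeftRightFKGLeftRightFKGCorner65Cert

/-!
# Line `corner-localisation` (lead c4, skeleton v9 = v8 + all-sizes tool stubs) — crux `LeftRightFKG` (stmt-CriticalPhenomena-11232)

Route `route-CriticalPhenomena-SAWLeftRightFKG`, crux decl
`Summit.CriticalPhenomena.SAWScalingLimit.Theses.SAWLeftRightFKG.LeftRightFKG` (left–right positive
association of the critical square-lattice SAW chord measure in a simply connected lattice domain between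
boundary-adjacent endpoints).

## State inherited from leads 0 / c1 / c2 (all in the tree)

* lead 0: `CornerLoc.stub_reduction : CornerCritical → LeftRightFKG` (p98583), `CornerCritical = Corner x_c`;
* lead c1: `CornerLoc.CornerAssembly.corner_of_parts : 0 < x → (∀ Ω δ a b, ClassDictionaryAt Ω δ a b) →
  AllMeetProportionalAt x → CornerQuadrupleTP2At x → Corner x` (p124453, with `stub_classDictionary` p124310 and
  `stub_allMeetProportional` p123983 landed), and `CornerQuadrupleTP2At x ⟸ InterlacedTP2At x` (p124147);
* lead c2 (skeleton v7): `InterlacedTP2At x ↔ GraphTP2At x ∧ ThreePointAt x`; TWO open stubs, `stub_graphTP2 :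
  BoundaryTP2.GraphTP2At x_c` (verbatim the core of the sibling crux `SAWTotalPositivity.BoundaryTP2`, stmt-7115) and
  `stub_threePoint : ThreePointAt x_c` (three-point splitting at every vertex with ONE isolated lattice neighbour — a
  second new conjecture).

## The reshape (lead c3, 2026-08-17, skeleton v8): `CornerQuadrupleTP2At x ⟸ GraphTP2At x` ALONE (`0 < x < 1`)

The corner assembly consumes only `CornerQuadrupleTP2At x`: TP₂ of corner quadruples `(u, w, w', u')` of a finite
`H ≤ ℤ²`, where `u ≠ u'` are lattice neighbours of an ISOLATED vertex `p` and `w ≠ w'` lattice neighbours of an isolated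
vertex `q ≠ p`. Every three-point / unit-bound instance this needs sits at a vertex with TWO escape routes into the
complement (`p` and `q`), and follows from `GraphTP2At x` by a finite gadget evaluated EXACTLY with the sibling's
first-step toolkit (`BoundaryTP2.pathKernel_firstStep_pair/_single`, `stub_pathKernelOn_avoid`, cut-vertex
factorisation), in the manner of the sibling's landed `SquareGadget.pathKernel_le_one_of_graphTP2At`:

* `stub_visitDeg2` (S): kernel identity for paths THROUGH a degree-2 vertex `c` with `N(c) = {s, r}`, starting at `s`:
  `Σ_{γ : s → t, c ∈ γ} x^{|γ|} = x² · Z_{G − c − s}(r, t)` (the path is `s c r …`);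
* `stub_chainGadget` (M): CHAIN GADGET — hang `c–p–b` (`p` isolated, lattice-adjacent to `c` and `b`) on `H` and apply
  `GraphTP2At` to `(b, a, c, p)`; the gadget kernels are `Z(b,c) + x²`, `x[Z(c,a) + Z(a,b)]`, `≤ Z(a,b) + x² Z(c,a)`,
  `x[1 + Z(b,c)]`, and TP₂ reads `(1 − x²)(Z(c,a)Z(c,b) − Z(a,b)) ≤ 0`: the three-point inequality at `c`, under the
  realisability conditions "`a, b` connected in `H − c`" and "`a, c` connected in `H − b`";
* `stub_twoChainThreePoint` (M): with a second chain `c–q–a` all degenerate cases close (cut vertex at `c`: equality by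
  factorisation; `b` separates `a` from `c`: use the `q`-chain; both: `Z(c,a) = 0`): the THREE-POINT INEQUALITY AT A
  VERTEX WITH TWO CHAINS, from the chain gadget alone;
* `stub_blobGadget` (M): BLOB GADGET — for a one-vertex cut `z` of `H` between `{u, w} ⊆ A` and `u' ∈ B`, hang `u–p–u'`
  and apply `GraphTP2At` to `(u, w, z, p)`: with `β = Z_B(z,u')` the kernels are `Z_A(u,z) + x²β`,
  `x[Z(u,w) + Z_A(w,z)β]`, `≤ Z(u,w) + x² Z_A(w,z)β`, `x[Z_A(u,z) + β]`, and TP₂ reads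
  `β(1 − x²)(Z_A(u,z)Z_A(w,z) − Z(u,w)) ≤ 0`: the bracket of c2's Menger decomposition, WITHOUT a three-point hypothesis;
* `stub_squareLeOne` (M): 4-CYCLE GADGET — for `u ≠ u'` with two common isolated lattice neighbours `p ≠ q`, hang
  `u–p–u'`, `u–q–u'` and apply `GraphTP2At` to `(u, p, u', q)`: `(Z + 2x²)·2x²(1+Z) ≤ x²(1 + Z + x²)²` forces
  `Z_H(u,u') ≤ 1`;
* `stub_cornerQuadrupleOfGraphTP2` (L, held by the lead): c1's coincidence analysis (`u = w'`/`u' = w`: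
  sub-multiplicativity, no TP₂; `u = w` xor `u' = w'`: two-chain three-point at the common vertex; both: the 4-cycle
  bound) and c2's Menger decomposition of the pairwise-distinct case (`GraphTP2At` instance, or cut vertex `z`:
  equality, or two brackets — each bracket by the blob gadget through `p` or through `q`, the doubly-degenerate case
  being `Z = 0`) give `CornerQuadrupleTP2At x` from `GraphTP2At x` and the three gadget statements;
* `stub_graphTP2` (OPEN — the sibling core, verbatim stmt-7115's registered open stub): `BoundaryTP2.GraphTP2At x_c`.

Composition: `LeftRightFKG_of h := stub_reduction (corner_of_parts _ stub_classDictionary (stub_allMeetProportional …)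
(stub_cornerQuadrupleOfGraphTP2 x_c … h GL (stub_twoChainThreePoint … GL) (stub_blobGadget … h stub_visitDeg2)
(stub_squareLeOne … h stub_visitDeg2)))` with `GL := stub_chainGadget … h stub_visitDeg2` — kernel-checked below. After v8 the crux is formally
a COROLLARY OF THE SIBLING CORE: `GraphTP2At x_c → LeftRightFKG`; c2's `stub_threePoint` (`ThreePointAt x_c`) is no
longer on the path (bypassed, not refuted: it remains a consequence of `InterlacedTP2At x_c`).

`Disproof.lean` (cdisprove cycles 1–2) honoured: boundary adjacency of both marked points stays load-bearing (it is what
provides the two escape routes `p = π k`, `q = σ m` of every corner quadruple, and `StepMonotone`); nothing spends a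
uniform `ε`; every gadget inequality is an EXACT polynomial identity in the kernels, `x_c`-sharpness enters only through
the open core (`BoundaryTP2.not_graphTP2At_of_criticalFugacity_lt`, landed).
-/

noncomputable section

open MeasureTheory
open Literature.Probability.LatticeModels Literature.Probability.RandomPlanarGeometry
open Summit.CriticalPhenomena.SAWScalingLimit.Theorems
open Summit.CriticalPhenomena.SAWScalingLimit.Theorems.LeftRightFKG.CornerLoc
open Summit.CriticalPhenomena.SAWScalingLimit.Theorems.BoundaryTP2 (pathKernel pathKernelOn GraphTP2At)
open scoped Classical ENNReal

namespace Summit.CriticalPhenomena.SAWScalingLimit.Cruxes.LeftRightFKG.CornerLocalisation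

/-! ## Registered stubs (v8) — stubs 1–6 LANDED (2026-08-17), stub 7 OPEN -/

/-- STUB 1 (S) — LANDED (p141841, `…StubVisitDeg2.lean`, worker) `stub_visitDeg2`: paths through a degree-2 vertex. If `N_G(c) = {s, r}` with `s ≠ r`, then for
`t ≠ c, s` the self-avoiding paths `s → t` visiting `c` are exactly `s c r · δ` with `δ : r → t` a path of `G − c − s`,
so their kernel is `x² · Z_{G−c−s}(r,t)` (for `t = r`: `x²`). [folklore] -/
theorem stub_visitDeg2 : ∀ (G : SimpleGraph (Site 2)) (x : ℝ) (c s r t : Site 2), 0 ≤ x →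
    G.neighborSet c = {s, r} → s ≠ r → t ≠ c → t ≠ s →
    pathKernelOn G x s t {γ | c ∈ γ.1.support} =
      ENNReal.ofReal (x ^ 2) * pathKernel (G.deleteEdges (G.incidenceSet c ∪ G.incidenceSet s)) x r t :=
  Summit.CriticalPhenomena.SAWScalingLimit.Theorems.LeftRightFKG.CornerGadget.stub_visitDeg2

/-- STUB 2 (M) — LANDED (p141931, `…StubSquareLeOne.lean`, worker) `stub_squareLeOne`: the 4-CYCLE GADGET — `GraphTP2At x` (`0 < x < 1`) and stub 1's identity force
`Z_H(u,u') ≤ 1` whenever `u ≠ u'` have two common lattice neighbours `p ≠ q` isolated in `H` (hang `u p u'`, `u q u'`;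
quadruple `(u,p,u',q)`; `(Z+2x²)·2x²(1+Z) ≤ x²(1+Z+x²)²`). [folklore] -/
theorem stub_squareLeOne : ∀ x : ℝ, 0 < x → x < 1 → GraphTP2At x →
    (∀ (G : SimpleGraph (Site 2)) (x : ℝ) (c s r t : Site 2), 0 ≤ x →
      G.neighborSet c = {s, r} → s ≠ r → t ≠ c → t ≠ s →
      pathKernelOn G x s t {γ | c ∈ γ.1.support} =
        ENNReal.ofReal (x ^ 2) * pathKernel (G.deleteEdges (G.incidenceSet c ∪ G.incidenceSet s)) x r t) →
    ∀ (H : SimpleGraph (Site 2)), H ≤ zdGraph 2 → H.support.Finite →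
    ∀ u u' p q : Site 2, u ≠ u' → p ≠ q → p ∉ H.support → q ∉ H.support →
      (zdGraph 2).Adj p u → (zdGraph 2).Adj p u' → (zdGraph 2).Adj q u → (zdGraph 2).Adj q u' →
      pathKernel H x u u' ≤ 1 :=
  Summit.CriticalPhenomena.SAWScalingLimit.Theorems.LeftRightFKG.CornerGadget.stub_squareLeOne

/-- STUB 3 (M) — LANDED (p141778, `…StubChainGadget.lean`, worker) `stub_chainGadget`: the CHAIN GADGET — from `GraphTP2At x` (`0 < x < 1`) and stub 1's identity: for
pairwise distinct `c, a, b`, an isolated `p` lattice-adjacent to `c` and `b`, with `a, b` connected in `H − c` and `a, c`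
connected in `H − b`: `Z(c,a) Z(c,b) ≤ Z(a,b)` (hang `c p b`, quadruple `(b, a, c, p)`, exact kernels, cancel
`1 − x² > 0`). [folklore] -/
theorem stub_chainGadget : ∀ x : ℝ, 0 < x → x < 1 → GraphTP2At x →
    (∀ (G : SimpleGraph (Site 2)) (x : ℝ) (c s r t : Site 2), 0 ≤ x →
      G.neighborSet c = {s, r} → s ≠ r → t ≠ c → t ≠ s →
      pathKernelOn G x s t {γ | c ∈ γ.1.support} =
        ENNReal.ofReal (x ^ 2) * pathKernel (G.deleteEdges (G.incidenceSet c ∪ G.incidenceSet s)) x r t) →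
    ∀ (H : SimpleGraph (Site 2)), H ≤ zdGraph 2 → H.support.Finite →
    ∀ c a b p : Site 2, c ≠ a → c ≠ b → a ≠ b → p ∉ H.support → (zdGraph 2).Adj c p → (zdGraph 2).Adj p b →
      (H.deleteEdges (H.incidenceSet c)).Reachable a b → (H.deleteEdges (H.incidenceSet b)).Reachable a c →
      pathKernel H x c a * pathKernel H x c b ≤ pathKernel H x a b :=
  Summit.CriticalPhenomena.SAWScalingLimit.Theorems.LeftRightFKG.CornerGadget.stub_chainGadget

/-- STUB 4 (M) — LANDED (p142706, `…StubBlobGadget.lean`, worker) `stub_blobGadget`: the BLOB GADGET — from `GraphTP2At x` (`0 < x < 1`) and stub 1's identity: if `z` is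
a one-vertex cut of `H` (cut data `A`, `B` as in `BoundaryTP2.stub_cutVertex_factor`) with `u ≠ w` in `A`, `u'` in `B`,
all three different from `z`, `p` isolated and lattice-adjacent to `u` and `u'`, `Z_H(z,u') ≠ 0`, `u, w` connected in
`H − z` and `w, z` connected in `H − u`, then the `A`-side bracket holds: `Z_A(u,z) Z_A(w,z) ≤ Z_H(u,w)` (hang `u p u'`,
quadruple `(u, w, z, p)`, exact kernels through the cut, cancel `β(1 − x²) > 0`). [folklore] -/
theorem stub_blobGadget : ∀ x : ℝ, 0 < x → x < 1 → GraphTP2At x →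
    (∀ (G : SimpleGraph (Site 2)) (x : ℝ) (c s r t : Site 2), 0 ≤ x →
      G.neighborSet c = {s, r} → s ≠ r → t ≠ c → t ≠ s →
      pathKernelOn G x s t {γ | c ∈ γ.1.support} =
        ENNReal.ofReal (x ^ 2) * pathKernel (G.deleteEdges (G.incidenceSet c ∪ G.incidenceSet s)) x r t) →
    ∀ (H : SimpleGraph (Site 2)), H ≤ zdGraph 2 → H.support.Finite →
    ∀ (A B : Set (Site 2)) (z u w u' p : Site 2),
      (∀ v, v ∈ A ∨ v ∈ B) → (∀ v, v ∈ A → v ∈ B → v = z) → z ∈ A → z ∈ B →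
      (∀ a b, H.Adj a b → (a ∈ A ∧ b ∈ A) ∨ (a ∈ B ∧ b ∈ B)) →
      u ∈ A → w ∈ A → u' ∈ B → z ≠ u → z ≠ w → z ≠ u' → u ≠ w →
      p ∉ H.support → (zdGraph 2).Adj u p → (zdGraph 2).Adj p u' →
      pathKernel H x z u' ≠ 0 →
      (H.deleteEdges (H.incidenceSet z)).Reachable u w → (H.deleteEdges (H.incidenceSet u)).Reachable w z →
      pathKernel (SimpleGraph.fromRel fun a b => H.Adj a b ∧ a ∈ A ∧ b ∈ A) x u z *
        pathKernel (SimpleGraph.fromRel fun a b => H.Adj a b ∧ a ∈ A ∧ b ∈ A) x w z ≤ pathKernel H x u w :=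
  Summit.CriticalPhenomena.SAWScalingLimit.Theorems.LeftRightFKG.CornerGadget.stub_blobGadget

/-- STUB 5 (M) — LANDED (p141715, `…StubTwoChainThreePoint.lean`, worker) `stub_twoChainThreePoint`: THREE-POINT AT A VERTEX WITH TWO CHAINS, from the chain-gadget statement
(stub 3's conclusion at fugacity `x`) alone: for pairwise distinct `c, a, b` and isolated `p ≠ q` with `p` lattice-adjacent
to `c, b` and `q` to `c, a`: `Z(c,a) Z(c,b) ≤ Z(a,b)` — if `c` separates `a` from `b` this is an equality
(`BoundaryTP2.stub_cutVertex_factor`); otherwise the `p`-chain applies unless `b` separates `a` from `c`, the `q`-chain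
unless `a` separates `b` from `c`, and both separations force `Z(c,a) = 0`. [folklore] -/
theorem stub_twoChainThreePoint : ∀ x : ℝ, 0 ≤ x →
    (∀ (H : SimpleGraph (Site 2)), H ≤ zdGraph 2 → H.support.Finite →
      ∀ c a b p : Site 2, c ≠ a → c ≠ b → a ≠ b → p ∉ H.support → (zdGraph 2).Adj c p → (zdGraph 2).Adj p b →
        (H.deleteEdges (H.incidenceSet c)).Reachable a b → (H.deleteEdges (H.incidenceSet b)).Reachable a c →
        pathKernel H x c a * pathKernel H x c b ≤ pathKernel H x a b) →
    ∀ (H : SimpleGraph (Site 2)), H ≤ zdGraph 2 → H.support.Finite →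
    ∀ c a b p q : Site 2, c ≠ a → c ≠ b → a ≠ b → p ≠ q → p ∉ H.support → q ∉ H.support →
      (zdGraph 2).Adj c p → (zdGraph 2).Adj p b → (zdGraph 2).Adj c q → (zdGraph 2).Adj q a →
      pathKernel H x c a * pathKernel H x c b ≤ pathKernel H x a b :=
  Summit.CriticalPhenomena.SAWScalingLimit.Theorems.LeftRightFKG.CornerGadget.stub_twoChainThreePoint

/-- STUB 6 (L) — LANDED (p142703, `…StubCornerQuadrupleOfGraphTP2.lean` + bracket helper `…GadgetBracket.lean` p141774/p142634, lead c3) `stub_cornerQuadrupleOfGraphTP2`: `GraphTP2At x` (`0 < x < 1`) together with the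
chain gadget (stub 3), the two-chain three-point statement (stub 5), the blob bracket (stub 4) and the 4-cycle bound
(stub 2) — their conclusions at fugacity `x` — give `CornerQuadrupleTP2At x`: c1's coincidence analysis and c2's Menger
decomposition, with every three-point / unit-bound input now supplied by a gadget at the isolated marked points `p`, `q`
(brackets: blob through `p` or `q`; when the cut vertex IS `u'` resp. `w'`, the chain `u'–p–u` resp. `w'–q–w` instead).
[cite: Diestel2017, Thm. 3.3.1] -/
theorem stub_cornerQuadrupleOfGraphTP2 : ∀ x : ℝ, 0 < x → x < 1 → GraphTP2At x →
    (∀ (H : SimpleGraph (Site 2)), H ≤ zdGraph 2 → H.support.Finite →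
      ∀ c a b p : Site 2, c ≠ a → c ≠ b → a ≠ b → p ∉ H.support → (zdGraph 2).Adj c p → (zdGraph 2).Adj p b →
        (H.deleteEdges (H.incidenceSet c)).Reachable a b → (H.deleteEdges (H.incidenceSet b)).Reachable a c →
        pathKernel H x c a * pathKernel H x c b ≤ pathKernel H x a b) →
    (∀ (H : SimpleGraph (Site 2)), H ≤ zdGraph 2 → H.support.Finite →
      ∀ c a b p q : Site 2, c ≠ a → c ≠ b → a ≠ b → p ≠ q → p ∉ H.support → q ∉ H.support →
        (zdGraph 2).Adj c p → (zdGraph 2).Adj p b → (zdGraph 2).Adj c q → (zdGraph 2).Adj q a →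
        pathKernel H x c a * pathKernel H x c b ≤ pathKernel H x a b) →
    (∀ (H : SimpleGraph (Site 2)), H ≤ zdGraph 2 → H.support.Finite →
      ∀ (A B : Set (Site 2)) (z u w u' p : Site 2),
        (∀ v, v ∈ A ∨ v ∈ B) → (∀ v, v ∈ A → v ∈ B → v = z) → z ∈ A → z ∈ B →
        (∀ a b, H.Adj a b → (a ∈ A ∧ b ∈ A) ∨ (a ∈ B ∧ b ∈ B)) →
        u ∈ A → w ∈ A → u' ∈ B → z ≠ u → z ≠ w → z ≠ u' → u ≠ w →
        p ∉ H.support → (zdGraph 2).Adj u p → (zdGraph 2).Adj p u' →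
        pathKernel H x z u' ≠ 0 →
        (H.deleteEdges (H.incidenceSet z)).Reachable u w → (H.deleteEdges (H.incidenceSet u)).Reachable w z →
        pathKernel (SimpleGraph.fromRel fun a b => H.Adj a b ∧ a ∈ A ∧ b ∈ A) x u z *
          pathKernel (SimpleGraph.fromRel fun a b => H.Adj a b ∧ a ∈ A ∧ b ∈ A) x w z ≤ pathKernel H x u w) →
    (∀ (H : SimpleGraph (Site 2)), H ≤ zdGraph 2 → H.support.Finite →
      ∀ u u' p q : Site 2, u ≠ u' → p ≠ q → p ∉ H.support → q ∉ H.support →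
        (zdGraph 2).Adj p u → (zdGraph 2).Adj p u' → (zdGraph 2).Adj q u → (zdGraph 2).Adj q u' →
        pathKernel H x u u' ≤ 1) →
    CornerQuadrupleTP2At x :=
  Summit.CriticalPhenomena.SAWScalingLimit.Theorems.LeftRightFKG.CornerGadget.stub_cornerQuadrupleOfGraphTP2

/-- STUB 7 (OPEN — crux-sized; VERBATIM the registered open stub `stub_graphTP2` of the sibling crux
`SAWTotalPositivity.BoundaryTP2`, stmt-CriticalPhenomena-7115, line `Sketch`): boundary TP₂ of the critical self-avoiding
path kernel — for every finite `H ≤ ℤ²` and every interlaced quadruple disjointly realisable in both nested pairings,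
`Z₁₃Z₂₄ ≤ Z₁₂Z₃₄` at `x_c`. A new conjecture, not in print (sibling leads c1–c4): numerically true on ≈ 1.2e9 enumerated
instances, asymptotically tight, false at every `x_c < x < 1` (`BoundaryTP2.not_graphTP2At_of_criticalFugacity_lt`,
landed). [folklore] -/
theorem stub_graphTP2 : GraphTP2At SAW.criticalFugacity := by
  sorry

/-! ## Name-keyed alias of the ONE open statement (hypothesis of the composition) -/
namespace Registered

/-- Alias of stub 7's statement (the sibling core) keyed by the registered stub name. [folklore] -/
abbrev stub_graphTP2 : Prop := GraphTP2At SAW.criticalFugacity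

end Registered

/-! ## Composition (kernel-checked, no `sorry` of its own) -/

/-- Corner quadruples from the core at every `0 < x < 1`: the closed stubs 1–6 composed. [folklore] -/
theorem cornerQuadrupleTP2At_of_graphTP2At {x : ℝ} (hx0 : 0 < x) (hx1 : x < 1) (h : GraphTP2At x) :
    CornerQuadrupleTP2At x :=
  stub_cornerQuadrupleOfGraphTP2 x hx0 hx1 h (stub_chainGadget x hx0 hx1 h stub_visitDeg2)
    (stub_twoChainThreePoint x hx0.le (stub_chainGadget x hx0 hx1 h stub_visitDeg2))
    (stub_blobGadget x hx0 hx1 h stub_visitDeg2) (stub_squareLeOne x hx0 hx1 h stub_visitDeg2)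

/-- Corner positivity from the core at every `0 < x < 1` (c1's landed `corner_of_parts` with its landed inputs
`stub_classDictionary`, `stub_allMeetProportional`). [folklore] -/
theorem corner_of_graphTP2At {x : ℝ} (hx0 : 0 < x) (hx1 : x < 1) (h : GraphTP2At x) : Corner x :=
  CornerAssembly.corner_of_parts hx0 stub_classDictionary (stub_allMeetProportional x hx0)
    (cornerQuadrupleTP2At_of_graphTP2At hx0 hx1 h)

/-- THE LINE (v8): the ONE open stub statement — the sibling core `GraphTP2At x_c`, keyed by its registered name —
gives `CornerCritical = Corner x_c` and hence the crux BY NAME through lead 0's landed Transfer `stub_reduction`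
(p98583). [folklore] -/
theorem LeftRightFKG_of (h : Registered.stub_graphTP2) :
    Summit.CriticalPhenomena.SAWScalingLimit.Theses.SAWLeftRightFKG.LeftRightFKG :=
  stub_reduction
    (corner_of_graphTP2At SAW.criticalFugacity_pos_lt_one'.1 SAW.criticalFugacity_pos_lt_one'.2 h)

/-- WIRING CHECK: the sorried open stub feeds `LeftRightFKG_of` as stated (an `example`, so that `LeftRightFKG_of`
stays the only theorem concluding the crux). -/
example : Summit.CriticalPhenomena.SAWScalingLimit.Theses.SAWLeftRightFKG.LeftRightFKG :=
  LeftRightFKG_of stub_graphTP2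

/-- CONSISTENCY WITH v6/v7: the core also gives v6's single stub `InterlacedTP2At x_c` restricted to what the corner
assembly uses, namely `CornerQuadrupleTP2At x_c` — so nothing proved against v6/v7 is lost (`corner_of_parts` is the
same road). -/
example : CornerQuadrupleTP2At SAW.criticalFugacity :=
  cornerQuadrupleTP2At_of_graphTP2At SAW.criticalFugacity_pos_lt_one'.1 SAW.criticalFugacity_pos_lt_one'.2
    stub_graphTP2


/-! ## Tool stubs of lead c4 (v9): all-sizes statements about the crux's OWN instances

The composition above is unchanged (ONE open stub, the sibling core). The stubs below do not feed `LeftRightFKG_of`; they are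
the registered sub-goals of lead c4's programme (certificate objective): typed INFINITE FAMILIES of crux instances and the
infrastructure they need — every lattice rectangle realised as a crux domain `dom C 1` for ALL sizes (T1 + the landed
`Negative.Rect` lemmas), the first/last-step up-set lemma at a bottom-row marked point (T2), an FKG transfer principle for
chord posets that embed monotonically and bijectively in a finite distributive lattice with submodular length (T3, Mathlib's
four-functions `fkg`), and the structure theorem of the 2-row ladder (T4a/T4b: chords `(0,0) → (L,0)` of `{0..L}×{0,1}` ↔
`Fin L → Bool` by facewise crossing indicators, order = pointwise, length submodular). `ladderPA` assembles T1/T3/T4 into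
LEFT–RIGHT POSITIVE ASSOCIATION ON EVERY LADDER AT EVERY FUGACITY `0 ≤ x ≤ 1` — in particular the crux's inequality for the
instances `(δ, C, a, b, a', b') = (1, ∂[-1,L+1]×[-1,2], (0,0), (L,0), (0,-1), (L,-1))`, all `L`.
-/

section ToolsC4

open Summit.CriticalPhenomena.SAWScalingLimit.Theorems.LeftRightFKG.Negative (bx pathCross wcross)
open Summit.CriticalPhenomena.SAWScalingLimit.Theorems.LeftRightFKG

/-- STUB T1 (M) — LANDED (p145993, `…RectBoundaryWalk.lean`, worker) `stub_rectBoundaryWalk`: for every lattice rectangle `[x₀, x₁] × [y₀, y₁]` (`x₀ < x₁`, `y₀ < y₁`) there is a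
closed lattice walk based at the corner `(x₀, y₀)` tracing its boundary counter-clockwise, with the five decidable side
conditions of `Negative.Rect.meshVertices_Ω` / `meshDomain_Ω` / `dAdj_iff`: support in the closed rectangle, consecutive
vertices on a common wall line, every wall lattice point visited, and signed crossing count `-1` over the probe of the
corner face `(x₀, y₀)` (so `Rect.Ω C = dom C 1` has discrete domain the open box `(x₀,x₁) × (y₀,y₁)`). [folklore] -/
theorem stub_rectBoundaryWalk : ∀ (x₀ x₁ y₀ y₁ : ℤ), x₀ < x₁ → y₀ < y₁ →
    ∃ C : (zdGraph 2).Walk (bx x₀ y₀) (bx x₀ y₀),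
      (∀ x ∈ C.support, (x₀ ≤ x 0 ∧ x 0 ≤ x₁) ∧ (y₀ ≤ x 1 ∧ x 1 ≤ y₁)) ∧
      List.IsChain (fun p q : Site 2 => (p 1 = y₀ ∧ q 1 = y₀) ∨ (p 0 = x₁ ∧ q 0 = x₁) ∨
        (p 1 = y₁ ∧ q 1 = y₁) ∨ (p 0 = x₀ ∧ q 0 = x₀)) (bx x₀ y₀ :: C.support.tail) ∧
      (∀ i j : ℤ, x₀ ≤ i → i ≤ x₁ → y₀ ≤ j → j ≤ y₁ → (i = x₀ ∨ i = x₁ ∨ j = y₀ ∨ j = y₁) →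
        bx i j ∈ C.support) ∧
      pathCross x₀ y₀ (bx x₀ y₀) C.support.tail = -1 :=
  Families.stub_rectBoundaryWalk

/-- STUB T2 (M) — LANDED (p147837, `…FirstStepMonotone.lean`, worker) `stub_firstStepMonotone`: FIRST/LAST-STEP EVENTS AT A BOTTOM-ROW MARKED POINT ARE MONOTONE — in every
domain (`δ = 1`), unconditionally. If all vertices of two chords `γ₁ ≼ γ₂` (`lr`) lie weakly above the row of `a`, then
"first step West" passes UP (`γ₁` starts West ⇒ `γ₂` starts West) and "first step East" passes DOWN (`γ₂` starts East ⇒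
`γ₁` starts East); mirror at `b` for the last step (from the East passes up, from the West passes down). Mechanism: `lr`
forces `wcross m k γ₁ ≤ wcross m k γ₂` at every face (`wcross_le_of_wind_nonneg`); at the face `(a 0 - 1, a 1)` resp.
`(a 0, a 1)` the count is (net flow of the chord across the line `x = m + ½`, a constant of `a, b`) minus the contribution
of the unique bottom-row edge crossing that line, which a chord can only use as its first (resp. last) step. [folklore] -/
theorem stub_firstStepMonotone : ∀ (Ω : Set ℂ) (a b : Site 2) (γ₁ γ₂ : SAW.DomainSAW Ω 1 a b), a ≠ b → lr γ₁ γ₂ →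
    ((∀ v ∈ γ₁.walk.support, a 1 ≤ v 1) → (∀ v ∈ γ₂.walk.support, a 1 ≤ v 1) →
      (γ₁.walk.getVert 1 = bx (a 0 - 1) (a 1) → γ₂.walk.getVert 1 = bx (a 0 - 1) (a 1)) ∧
      (γ₂.walk.getVert 1 = bx (a 0 + 1) (a 1) → γ₁.walk.getVert 1 = bx (a 0 + 1) (a 1))) ∧
    ((∀ v ∈ γ₁.walk.support, b 1 ≤ v 1) → (∀ v ∈ γ₂.walk.support, b 1 ≤ v 1) →
      (γ₁.walk.reverse.getVert 1 = bx (b 0 + 1) (b 1) → γ₂.walk.reverse.getVert 1 = bx (b 0 + 1) (b 1)) ∧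
      (γ₂.walk.reverse.getVert 1 = bx (b 0 - 1) (b 1) → γ₁.walk.reverse.getVert 1 = bx (b 0 - 1) (b 1))) :=
  Families.stub_firstStepMonotone

/-- STUB T3 (M) — LANDED (p148792, `…FKGTransfer.lean`, worker) `stub_fkgTransfer`: FKG TRANSFER. If the chords of `(Ω, δ, a, b)` (a finite type) map BIJECTIVELY to a
finite distributive lattice `α` so that `f γ₁ ≤ f γ₂` implies `γ₁ ≼ γ₂` and chord length is submodular along `f`
(`|f⁻¹(p ⊓ q)| + |f⁻¹(p ⊔ q)| ≤ |f⁻¹ p| + |f⁻¹ q|`), then for every fugacity `0 ≤ x ≤ 1` the measure `μx x` is positively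
associated in the crux's event form: `μ(A) μ(B) ≤ μ(univ) μ(A ∩ B)` for `≼`-up-closed `A, B`. Proof: transport to `α`;
`x^{|·|}` is log-supermodular (`x ≤ 1`, submodularity); indicators of up-sets are monotone; Mathlib's `fkg`
(four-functions theorem); `μx_apply_eq_ofReal`. [cite: FortuinKasteleynGinibre1971, Thm 1] -/
theorem stub_fkgTransfer : ∀ (Ω : Set ℂ) (δ : ℝ) (a b : Site 2) [Fintype (SAW.DomainSAW Ω δ a b)]
    (α : Type) [DistribLattice α] [Fintype α] (f : SAW.DomainSAW Ω δ a b → α), Function.Bijective f →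
    (∀ γ₁ γ₂, f γ₁ ≤ f γ₂ → lr γ₁ γ₂) →
    (∀ γ₁ γ₂ γ₃ γ₄, f γ₃ = f γ₁ ⊓ f γ₂ → f γ₄ = f γ₁ ⊔ f γ₂ → γ₃.length + γ₄.length ≤ γ₁.length + γ₂.length) →
    ∀ x : ℝ, 0 ≤ x → x ≤ 1 → ∀ A B : Set (SAW.DomainSAW Ω δ a b), IsUp A → IsUp B →
      μx x Ω δ a b A * μx x Ω δ a b B ≤ μx x Ω δ a b Set.univ * μx x Ω δ a b (A ∩ B) :=
  Families.stub_fkgTransfer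

/-- STUB T4a (L) — LANDED (p151578 + aux p150912, `…LadderStructure(Aux).lean`, worker) `stub_ladderStructure`: COMBINATORICS OF THE 2-ROW LADDER. If `Ω_1` is the lattice graph induced on the
ladder `{0..L} × {0,1}` (adjacency = lattice adjacency inside the open box `(-1, L+1) × (-1, 2)`), then for the chords
`(0,0) → (L,0)`: (i) every chord stays in the ladder; (ii) each facewise crossing count `wcross i 0` (`i < L`) is `0` or `1`
(a corner-to-corner SAW of the ladder crosses each column gap exactly once, eastward — net flow `1` across the 2-edge cut,
each edge used at most once); (iii) `|γ| = L + #{i ≤ L : [1 ≤ wcross i 0 γ] ≠ [1 ≤ wcross (i-1) 0 γ]}` (one horizontal step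
per gap plus one rung per row change; the counts at the phantom faces `-1` and `L` vanish); (iv) a chord is determined by its
crossing counts; (v) every `0/1` pattern occurs. [folklore] -/
theorem stub_ladderStructure : ∀ (L : ℕ) (Ω : Set ℂ),
    (∀ u v : Site 2, (discreteDomainGraph Ω 1).Adj u v ↔
      (zdGraph 2).Adj u v ∧ u ∈ Negative.Rect.box (-1) (L + 1) (-1) 2 ∧ v ∈ Negative.Rect.box (-1) (L + 1) (-1) 2) →
    (∀ γ : SAW.DomainSAW Ω 1 (bx 0 0) (bx L 0),
      (∀ v ∈ γ.walk.support, (0 ≤ v 0 ∧ v 0 ≤ L) ∧ (0 ≤ v 1 ∧ v 1 ≤ 1)) ∧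
      (∀ i : ℕ, i < L → wcross i 0 γ.walk = 0 ∨ wcross i 0 γ.walk = 1) ∧
      γ.length = L + ((Finset.range (L + 1)).filter (fun i : ℕ =>
        decide (1 ≤ wcross i 0 γ.walk) ≠ decide (1 ≤ wcross ((i : ℤ) - 1) 0 γ.walk))).card) ∧
    (∀ γ₁ γ₂ : SAW.DomainSAW Ω 1 (bx 0 0) (bx L 0),
      (∀ i : ℕ, i < L → wcross i 0 γ₁.walk = wcross i 0 γ₂.walk) → γ₁ = γ₂) ∧
    (∀ v : Fin L → Bool, ∃ γ : SAW.DomainSAW Ω 1 (bx 0 0) (bx L 0),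
      ∀ i : Fin L, decide (1 ≤ wcross (i : ℤ) 0 γ.walk) = v i) :=
  Families.stub_ladderStructure

/-- STUB T4b (M) — LANDED (p153418, `…LadderChords.lean`, worker) `stub_ladderChords_of_structure` (v9c: `let`-free — the registrar truncates stub text at the first `:=`): from the ladder combinatorics (T4a, verbatim as hypothesis) to the
lattice-theoretic interface consumed by the FKG transfer: the crossing-indicator map `f γ = (1 ≤ wcross i 0 γ)_{i<L}` is a
BIJECTION onto `Fin L → Bool` ((iv)+(v)), pointwise `≤` implies `≼` (`wind_nonneg_iff_wcross` on the bounding box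
`[0,L]×[0,1]`, faces `(i,0)`, counts in `{0,1}` by (ii)), and length is submodular along `f` (formula (iii) and the bitwise
inequality `[p∧p' ≠ q∧q'] + [p∨p' ≠ q∨q'] ≤ [p ≠ q] + [p' ≠ q']`). [folklore] -/
theorem stub_ladderChords_of_structure :
    (∀ (L : ℕ) (Ω : Set ℂ),
      (∀ u v : Site 2, (discreteDomainGraph Ω 1).Adj u v ↔
        (zdGraph 2).Adj u v ∧ u ∈ Negative.Rect.box (-1) (L + 1) (-1) 2 ∧ v ∈ Negative.Rect.box (-1) (L + 1) (-1) 2) →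
      (∀ γ : SAW.DomainSAW Ω 1 (bx 0 0) (bx L 0),
        (∀ v ∈ γ.walk.support, (0 ≤ v 0 ∧ v 0 ≤ L) ∧ (0 ≤ v 1 ∧ v 1 ≤ 1)) ∧
        (∀ i : ℕ, i < L → wcross i 0 γ.walk = 0 ∨ wcross i 0 γ.walk = 1) ∧
        γ.length = L + ((Finset.range (L + 1)).filter (fun i : ℕ =>
          decide (1 ≤ wcross i 0 γ.walk) ≠ decide (1 ≤ wcross ((i : ℤ) - 1) 0 γ.walk))).card) ∧
      (∀ γ₁ γ₂ : SAW.DomainSAW Ω 1 (bx 0 0) (bx L 0),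
        (∀ i : ℕ, i < L → wcross i 0 γ₁.walk = wcross i 0 γ₂.walk) → γ₁ = γ₂) ∧
      (∀ v : Fin L → Bool, ∃ γ : SAW.DomainSAW Ω 1 (bx 0 0) (bx L 0),
        ∀ i : Fin L, decide (1 ≤ wcross (i : ℤ) 0 γ.walk) = v i)) →
    ∀ (L : ℕ) (Ω : Set ℂ),
    (∀ u v : Site 2, (discreteDomainGraph Ω 1).Adj u v ↔
      (zdGraph 2).Adj u v ∧ u ∈ Negative.Rect.box (-1) (L + 1) (-1) 2 ∧ v ∈ Negative.Rect.box (-1) (L + 1) (-1) 2) →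
    ∀ f : SAW.DomainSAW Ω 1 (bx 0 0) (bx L 0) → (Fin L → Bool),
    (∀ (γ : SAW.DomainSAW Ω 1 (bx 0 0) (bx L 0)) (i : Fin L), f γ i = decide (1 ≤ wcross (i : ℤ) 0 γ.walk)) →
    Function.Bijective f ∧
    (∀ γ₁ γ₂, f γ₁ ≤ f γ₂ → lr γ₁ γ₂) ∧
    (∀ γ₁ γ₂ γ₃ γ₄, f γ₃ = f γ₁ ⊓ f γ₂ → f γ₄ = f γ₁ ⊔ f γ₂ → γ₃.length + γ₄.length ≤ γ₁.length + γ₂.length) :=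
  Families.stub_ladderChords_of_structure

/-- T4 (glue, was the registered stub `stub_ladderChords` of v9; v9b derives it from T4a + T4b): STRUCTURE OF THE 2-ROW
LADDER in the form consumed by the FKG transfer — the crossing-indicator map is a bijection onto `Fin L → Bool`, pointwise `≤`
implies `≼`, and length is submodular along it. [folklore] -/
theorem ladderChords : ∀ (L : ℕ) (Ω : Set ℂ),
    (∀ u v : Site 2, (discreteDomainGraph Ω 1).Adj u v ↔
      (zdGraph 2).Adj u v ∧ u ∈ Negative.Rect.box (-1) (L + 1) (-1) 2 ∧ v ∈ Negative.Rect.box (-1) (L + 1) (-1) 2) →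
    let f : SAW.DomainSAW Ω 1 (bx 0 0) (bx L 0) → (Fin L → Bool) :=
      fun γ i => decide (1 ≤ wcross (i : ℤ) 0 γ.walk)
    Function.Bijective f ∧
    (∀ γ₁ γ₂, f γ₁ ≤ f γ₂ → lr γ₁ γ₂) ∧
    (∀ γ₁ γ₂ γ₃ γ₄, f γ₃ = f γ₁ ⊓ f γ₂ → f γ₄ = f γ₁ ⊔ f γ₂ → γ₃.length + γ₄.length ≤ γ₁.length + γ₂.length) :=
  fun L Ω hadj => stub_ladderChords_of_structure stub_ladderStructure L Ω hadj _ fun _ _ => rfl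

/-- STUB T5 (L) — LANDED (p156086, `…BoxLeafThreePoint.lean`, worker) `stub_boxLeafThreePoint`: WHAT THE CRUX QUANTIFIES ON BOXES (converse direction, lead c4 analysis §1).
For every lattice rectangle realised as `dom C 1` by a boundary walk `C` (the four side conditions of T1 as hypotheses) and
marked points `a = (i, y₀+1)`, `b = (i+2, y₀+1)` at distance 2 on the bottom row (common neighbour `c = (i+1, y₀+1)`), the
crux's inequality for the up-closed events `E = {first step ≠ c}`, `F = {last step ≠ c}` (up-closed by T2) is, through the
class dictionary at `k = m = 0` (chords with end-steps `(u', w')` ≃ paths `u' → w'` of the free graph `G` = the box graph with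
`a, b` isolated, lengths `+2`), EXACTLY the three-point inequality at the leaf `c` of `G`:
`(Σ_{u'∈{u,wₐ}} Z_G(u',c)) · (Σ_{w'∈{w,e'}} Z_G(c,w')) ≤ Σ_{u'∈{u,wₐ}, w'∈{w,e'}} Z_G(u',w')` with `u = (i,y₀+2)`,
`wₐ = (i-1,y₀+1)`, `w = (i+2,y₀+2)`, `e' = (i+3,y₀+1)` (kernels at wall sites vanish) — a discounted three-point inequality
`x_c²·K₁K₂ ≤ N₀` among critical boundary kernels of EVERY box: the crux is lattice-precision on its own instances. [folklore] -/
theorem stub_boxLeafThreePoint : Summit.CriticalPhenomena.SAWScalingLimit.Theses.SAWLeftRightFKG.LeftRightFKG →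
    ∀ (x₀ x₁ y₀ y₁ i : ℤ) (C : (zdGraph 2).Walk (bx x₀ y₀) (bx x₀ y₀)),
      (∀ x ∈ C.support, (x₀ ≤ x 0 ∧ x 0 ≤ x₁) ∧ (y₀ ≤ x 1 ∧ x 1 ≤ y₁)) →
      List.IsChain (fun p q : Site 2 => (p 1 = y₀ ∧ q 1 = y₀) ∨ (p 0 = x₁ ∧ q 0 = x₁) ∨
        (p 1 = y₁ ∧ q 1 = y₁) ∨ (p 0 = x₀ ∧ q 0 = x₀)) (bx x₀ y₀ :: C.support.tail) →
      (∀ i' j : ℤ, x₀ ≤ i' → i' ≤ x₁ → y₀ ≤ j → j ≤ y₁ → (i' = x₀ ∨ i' = x₁ ∨ j = y₀ ∨ j = y₁) →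
        bx i' j ∈ C.support) →
      pathCross x₀ y₀ (bx x₀ y₀) C.support.tail = -1 →
      x₀ < i → i + 2 < x₁ → y₀ + 2 < y₁ →
      ∀ G : SimpleGraph (Site 2), G = freeGraph (dom C 1) 1 0 (fun _ => bx i (y₀ + 1)) 0 (fun _ => bx (i + 2) (y₀ + 1)) →
        (pathKernel G SAW.criticalFugacity (bx i (y₀ + 2)) (bx (i + 1) (y₀ + 1)) +
            pathKernel G SAW.criticalFugacity (bx (i - 1) (y₀ + 1)) (bx (i + 1) (y₀ + 1))) *
          (pathKernel G SAW.criticalFugacity (bx (i + 1) (y₀ + 1)) (bx (i + 2) (y₀ + 2)) +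
            pathKernel G SAW.criticalFugacity (bx (i + 1) (y₀ + 1)) (bx (i + 3) (y₀ + 1))) ≤
        pathKernel G SAW.criticalFugacity (bx i (y₀ + 2)) (bx (i + 2) (y₀ + 2)) +
          pathKernel G SAW.criticalFugacity (bx i (y₀ + 2)) (bx (i + 3) (y₀ + 1)) +
          pathKernel G SAW.criticalFugacity (bx (i - 1) (y₀ + 1)) (bx (i + 2) (y₀ + 2)) +
          pathKernel G SAW.criticalFugacity (bx (i - 1) (y₀ + 1)) (bx (i + 3) (y₀ + 1)) :=
  Families.stub_boxLeafThreePoint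

/-- STUB T8 (M) — LANDED (p156657, `…BoxCornerMinor.lean`, worker) `stub_boxCornerMinor`: WHAT THE CRUX QUANTIFIES ON BOXES, II — the homogeneous corner minor. For every
lattice rectangle realised as `dom C 1` (T1's side conditions as hypotheses) with the marked points at the two BOTTOM CORNERS
`a = (x₀+1, y₀+1)`, `b = (x₁-1, y₀+1)` (two first steps `u₁ = a + e₀` (East), `u₂ = a + e₁` (North); two last steps from
`w₁ = b - e₀` (West), `w₂ = b + e₁` (North)), the crux's inequality for the up-closed events `{first step North}`,
`{last step from the North}` (T2) is, through the class dictionary at `k = m = 0`, EXACTLY the `2 × 2` TP₂ minor of the critical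
kernel of the free graph `G` (the box graph with `a, b` isolated) for the outer-face quadruple `(u₁, w₁, w₂, u₂)`:
crossed `Z_G(u₂,w₁)·Z_G(u₁,w₂) ≤` nested `Z_G(u₁,w₁)·Z_G(u₂,w₂)` — a `GraphTP2At x_c`-type instance on every box, read off the
crux itself (converse direction of the line's reduction on this family). [folklore] -/
theorem stub_boxCornerMinor : Summit.CriticalPhenomena.SAWScalingLimit.Theses.SAWLeftRightFKG.LeftRightFKG →
    ∀ (x₀ x₁ y₀ y₁ : ℤ) (C : (zdGraph 2).Walk (bx x₀ y₀) (bx x₀ y₀)),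
      (∀ x ∈ C.support, (x₀ ≤ x 0 ∧ x 0 ≤ x₁) ∧ (y₀ ≤ x 1 ∧ x 1 ≤ y₁)) →
      List.IsChain (fun p q : Site 2 => (p 1 = y₀ ∧ q 1 = y₀) ∨ (p 0 = x₁ ∧ q 0 = x₁) ∨
        (p 1 = y₁ ∧ q 1 = y₁) ∨ (p 0 = x₀ ∧ q 0 = x₀)) (bx x₀ y₀ :: C.support.tail) →
      (∀ i' j : ℤ, x₀ ≤ i' → i' ≤ x₁ → y₀ ≤ j → j ≤ y₁ → (i' = x₀ ∨ i' = x₁ ∨ j = y₀ ∨ j = y₁) →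
        bx i' j ∈ C.support) →
      pathCross x₀ y₀ (bx x₀ y₀) C.support.tail = -1 →
      x₀ + 4 ≤ x₁ → y₀ + 2 < y₁ →
      ∀ G : SimpleGraph (Site 2),
        G = freeGraph (dom C 1) 1 0 (fun _ => bx (x₀ + 1) (y₀ + 1)) 0 (fun _ => bx (x₁ - 1) (y₀ + 1)) →
        pathKernel G SAW.criticalFugacity (bx (x₀ + 1) (y₀ + 2)) (bx (x₁ - 2) (y₀ + 1)) *
            pathKernel G SAW.criticalFugacity (bx (x₀ + 2) (y₀ + 1)) (bx (x₁ - 1) (y₀ + 2)) ≤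
          pathKernel G SAW.criticalFugacity (bx (x₀ + 2) (y₀ + 1)) (bx (x₁ - 2) (y₀ + 1)) *
            pathKernel G SAW.criticalFugacity (bx (x₀ + 1) (y₀ + 2)) (bx (x₁ - 1) (y₀ + 2)) :=
  Families.stub_boxCornerMinor

/-! ### Notched boxes (v9f): the crux ⇒ the UNDISCOUNTED two-chain three-point inequality at every bottom notch

Geometry (walls `x₀ < x₁`, `y₀ < y₁`; notch column `x_s`): the domain is the open box of sites MINUS the bottom-row site
`s = (x_s, y₀+1)` (the boundary walk carries a unit spur `(x_s, y₀) → s → (x_s, y₀)`); marked points `a = (x_s-1, y₀+1)` (bottom row,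
left of the notch) and `b = (x_s, y₀+2)` (above the notch) — a DIAGONAL pair whose common neighbours are `v = (x_s-1, y₀+2)` (free) and
`s` (the notch); `a' = (x_s-1, y₀)` (wall), `b' = s` (spur tip). First steps at `a`: West `W = (x_s-2, y₀+1)` or North `v`; last steps
into `b`: from `v` (West), from `E_b = (x_s+1, y₀+2)`, from `N_b = (x_s, y₀+3)`. With `E = {first step West}` (up-closed, T2) and
`F = {last step not from v}` (up-closed: the edge `a–s` is absent, so `v–b` is the only used edge crossing `x = x_s - ½` at height
`≤ y₀+2`), the crux's inequality is `Z_G(W,v)·(Z_G(v,E_b) + Z_G(v,N_b)) ≤ Z_G(W,E_b) + Z_G(W,N_b)` in the free graph `G` (box∖{s}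
with `a, b` isolated): a GENUINE three-point inequality at the two-chain vertex `v` — no discount — on every notched box. In the dense
phase (`x > x_c`) its two sides scale like `e^{2fA}` vs `e^{fA}`: this is the instance on which x_c-sharpness of PA itself rests.
-/

/-- STUB T9b (L) — LANDED (p158533 + aux p158049, `…NotchedBoxWalk(Aux).lean`, worker) `stub_notchedBoxWalk`: every NOTCHED BOX is a crux domain. For walls `x₀ < x_s < x₁`, `y₀ + 2 < y₁` there is a closed
lattice walk `C` based at `(x₀, y₀)` (the rectangle walk of T1 with the unit spur `(x_s,y₀) → (x_s,y₀+1) → (x_s,y₀)` inserted) with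
`(x_s - 1, y₀)` and the spur tip `(x_s, y₀+1)` on it, whose discrete domain `meshDomain (dom C 1) 1` is the open box minus the notch site
and whose adjacency is lattice adjacency inside that set (the spur's two vertical darts contribute nothing to any `pathCross`, so all face
windings are those of the rectangle; the notch site lies on the trace, junk value `0`; box minus a bottom-row site of a box with `≥ 2` rows
is connected). [folklore] -/
theorem stub_notchedBoxWalk : ∀ (x₀ x₁ y₀ y₁ x_s : ℤ), x₀ < x_s → x_s < x₁ → y₀ + 2 < y₁ →
    ∃ C : (zdGraph 2).Walk (bx x₀ y₀) (bx x₀ y₀),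
      bx (x_s - 1) y₀ ∈ C.support ∧ bx x_s (y₀ + 1) ∈ C.support ∧
      meshDomain (dom C 1) 1 = Negative.Rect.box x₀ x₁ y₀ y₁ \ {bx x_s (y₀ + 1)} ∧
      (∀ u w : Site 2, (discreteDomainGraph (dom C 1) 1).Adj u w ↔
        (zdGraph 2).Adj u w ∧ u ∈ Negative.Rect.box x₀ x₁ y₀ y₁ \ {bx x_s (y₀ + 1)} ∧
          w ∈ Negative.Rect.box x₀ x₁ y₀ y₁ \ {bx x_s (y₀ + 1)}) :=
  Families.stub_notchedBoxWalk

/-- STUB T9c (L) — LANDED (p159256, `…NotchThreePoint.lean`, worker) `stub_notchThreePointOfIneq`: KERNEL BOOKKEEPING on the notched box. For any closed walk `C` whose discrete domain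
(`δ = 1`) has lattice adjacency inside `box ∖ {s}` (T9b's conclusion as hypothesis), any fugacity `0 < x`, and the marked diagonal pair
`a = (x_s-1, y₀+1)`, `b = (x_s, y₀+2)`: the ONE inequality `μ(E)μ(F) ≤ μ(univ)μ(E ∩ F)` of the fugacity-`x` chord measure for
`E = {first step West}`, `F = {last step not from v}` is equivalent (class dictionary at `k = m = 0`, `Z_G(v,v) = 1`) to the three-point
inequality at `v` in the free graph `G`: `Z_G(W,v)·(Z_G(v,E_b) + Z_G(v,N_b)) ≤ Z_G(W,E_b) + Z_G(W,N_b)`. [folklore] -/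
theorem stub_notchThreePointOfIneq : ∀ (x : ℝ) (x₀ x₁ y₀ y₁ x_s : ℤ) (C : (zdGraph 2).Walk (bx x₀ y₀) (bx x₀ y₀)),
    0 < x → x₀ + 2 < x_s → x_s + 1 < x₁ → y₀ + 3 < y₁ →
    (∀ u w : Site 2, (discreteDomainGraph (dom C 1) 1).Adj u w ↔
      (zdGraph 2).Adj u w ∧ u ∈ Negative.Rect.box x₀ x₁ y₀ y₁ \ {bx x_s (y₀ + 1)} ∧
        w ∈ Negative.Rect.box x₀ x₁ y₀ y₁ \ {bx x_s (y₀ + 1)}) →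
    μx x (dom C 1) 1 (bx (x_s - 1) (y₀ + 1)) (bx x_s (y₀ + 2))
        {γ | γ.walk.getVert 1 = bx (x_s - 2) (y₀ + 1)} *
      μx x (dom C 1) 1 (bx (x_s - 1) (y₀ + 1)) (bx x_s (y₀ + 2))
        {γ | γ.walk.reverse.getVert 1 ≠ bx (x_s - 1) (y₀ + 2)} ≤
    μx x (dom C 1) 1 (bx (x_s - 1) (y₀ + 1)) (bx x_s (y₀ + 2)) Set.univ *
      μx x (dom C 1) 1 (bx (x_s - 1) (y₀ + 1)) (bx x_s (y₀ + 2))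
        ({γ | γ.walk.getVert 1 = bx (x_s - 2) (y₀ + 1)} ∩ {γ | γ.walk.reverse.getVert 1 ≠ bx (x_s - 1) (y₀ + 2)}) →
    ∀ G : SimpleGraph (Site 2),
      G = freeGraph (dom C 1) 1 0 (fun _ => bx (x_s - 1) (y₀ + 1)) 0 (fun _ => bx x_s (y₀ + 2)) →
      pathKernel G x (bx (x_s - 2) (y₀ + 1)) (bx (x_s - 1) (y₀ + 2)) *
          (pathKernel G x (bx (x_s - 1) (y₀ + 2)) (bx (x_s + 1) (y₀ + 2)) +
            pathKernel G x (bx (x_s - 1) (y₀ + 2)) (bx x_s (y₀ + 3))) ≤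
        pathKernel G x (bx (x_s - 2) (y₀ + 1)) (bx (x_s + 1) (y₀ + 2)) +
          pathKernel G x (bx (x_s - 2) (y₀ + 1)) (bx x_s (y₀ + 3)) :=
  Families.stub_notchThreePointOfIneq

/-- STUB T9d (M) — LANDED (p159944, `…NotchUpClosed.lean`, worker) `stub_notchUpClosed`: on the notched box the two events of T9c are `≼`-UP-CLOSED: `{first step West}` at the
bottom-row point `a` by T2, and `{last step not from v}` because the edge `a–s` is missing (notch) so that `v → b` is the ONLY dart of a
chord crossing the line `x = x_s - ½` at height `≤ y₀ + 2`, whence `wcross (x_s - 1) (y₀ + 2) γ = T − [last step from v]` with `T`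
constant, and `lr` orders these counts. [folklore] -/
theorem stub_notchUpClosed : ∀ (x₀ x₁ y₀ y₁ x_s : ℤ) (C : (zdGraph 2).Walk (bx x₀ y₀) (bx x₀ y₀)),
    x₀ + 2 < x_s → x_s + 1 < x₁ → y₀ + 3 < y₁ →
    (∀ u w : Site 2, (discreteDomainGraph (dom C 1) 1).Adj u w ↔
      (zdGraph 2).Adj u w ∧ u ∈ Negative.Rect.box x₀ x₁ y₀ y₁ \ {bx x_s (y₀ + 1)} ∧
        w ∈ Negative.Rect.box x₀ x₁ y₀ y₁ \ {bx x_s (y₀ + 1)}) →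
    IsUp ({γ | γ.walk.getVert 1 = bx (x_s - 2) (y₀ + 1)} :
        Set (SAW.DomainSAW (dom C 1) 1 (bx (x_s - 1) (y₀ + 1)) (bx x_s (y₀ + 2)))) ∧
    IsUp ({γ | γ.walk.reverse.getVert 1 ≠ bx (x_s - 1) (y₀ + 2)} :
        Set (SAW.DomainSAW (dom C 1) 1 (bx (x_s - 1) (y₀ + 1)) (bx x_s (y₀ + 2)))) :=
  Families.stub_notchUpClosed

/-- GLUE (lead): **the crux ⇒ the two-chain three-point inequality at `x_c` on every notched box.** For walls `x₀ + 2 < x_s`,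
`x_s + 1 < x₁`, `y₀ + 3 < y₁`, the notched-box walk of T9b is an honest crux instance for the diagonal pair `(a, b)` (`a' = (x_s-1, y₀)`
on the wall, `b' = s` the spur tip), T9d makes the two events up-closed, the crux supplies the one inequality, and T9c reads it as
`Z_G(W,v)·(Z_G(v,E_b) + Z_G(v,N_b)) ≤ Z_G(W,E_b) + Z_G(W,N_b)`. [folklore] -/
theorem notchThreePoint (hLR : Summit.CriticalPhenomena.SAWScalingLimit.Theses.SAWLeftRightFKG.LeftRightFKG)
    (x₀ x₁ y₀ y₁ x_s : ℤ) (h₁ : x₀ + 2 < x_s) (h₂ : x_s + 1 < x₁) (h₃ : y₀ + 3 < y₁) :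
    ∃ C : (zdGraph 2).Walk (bx x₀ y₀) (bx x₀ y₀),
      meshDomain (dom C 1) 1 = Negative.Rect.box x₀ x₁ y₀ y₁ \ {bx x_s (y₀ + 1)} ∧
      ∀ G : SimpleGraph (Site 2),
        G = freeGraph (dom C 1) 1 0 (fun _ => bx (x_s - 1) (y₀ + 1)) 0 (fun _ => bx x_s (y₀ + 2)) →
        pathKernel G SAW.criticalFugacity (bx (x_s - 2) (y₀ + 1)) (bx (x_s - 1) (y₀ + 2)) *
            (pathKernel G SAW.criticalFugacity (bx (x_s - 1) (y₀ + 2)) (bx (x_s + 1) (y₀ + 2)) +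
              pathKernel G SAW.criticalFugacity (bx (x_s - 1) (y₀ + 2)) (bx x_s (y₀ + 3))) ≤
          pathKernel G SAW.criticalFugacity (bx (x_s - 2) (y₀ + 1)) (bx (x_s + 1) (y₀ + 2)) +
            pathKernel G SAW.criticalFugacity (bx (x_s - 2) (y₀ + 1)) (bx x_s (y₀ + 3)) := by
  obtain ⟨C, ha', hs, hdom, hadj⟩ := stub_notchedBoxWalk x₀ x₁ y₀ y₁ x_s (by omega) (by omega) (by omega)
  refine ⟨C, hdom, fun G hG => ?_⟩
  obtain ⟨hE, hF⟩ := stub_notchUpClosed x₀ x₁ y₀ y₁ x_s C h₁ h₂ h₃ hadj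
  have key := hLR 1 (bx x₀ y₀) (bx (x_s - 1) (y₀ + 1)) (bx x_s (y₀ + 2)) (bx (x_s - 1) y₀) (bx x_s (y₀ + 1)) C
    one_pos ha' hs (Negative.adj_bx _ _ _ _ (by omega)) (Negative.adj_bx _ _ _ _ (by omega)) _ _ hE hF
  rw [weight_eq_μx] at key
  exact stub_notchThreePointOfIneq SAW.criticalFugacity x₀ x₁ y₀ y₁ x_s C SAW.criticalFugacity_pos_lt_one'.1 h₁ h₂ h₃
    hadj key G hG

/-! ### A certified supercritical failure of left–right association (v9h): `¬ PA x` for every `0.61 ≤ x ≤ 1`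

On the `5 × 4` notched box (walls `0, 6, 0, 5`, notch column `3`; free graph `G` = the 17 sites of `(0,6)×(0,5)` minus
`{(3,1), (2,1), (3,2)}`) the notch three-point difference `R·Q − P` is the integer polynomial
`x⁴(−1 − 2x² − x⁴ + 6x⁶ + 35x⁸ + 77x¹⁰ + 98x¹² + 100x¹⁴ + 99x¹⁶ + 96x¹⁸ + 86x²⁰ + 64x²² + 34x²⁴ + 9x²⁶)` (exact enumeration: 621
paths from `W = (1,1)`, 628 from `v = (2,2)`; one sign change, root in `(0.60, 0.61)`), positive on `[61/100, 1]`. With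
`notchThreePoint_of_PA` this CERTIFIES `¬ PA x` for every `61/100 ≤ x ≤ 1` — left–right association provably fails on a whole
interval of supercritical fugacities (previously: at `x = 1` only, `NotFKGAtOne`); larger notched boxes / corner minors push the
certified edge down (`7 × 6` notch: `0.52`; `6 × 6` bottom-corner minor: `0.49`), towards `x_c = 0.379…`.
-/

/-- STUB T10 (M) — LANDED (p161792, `…Notch54Cert.lean`, worker; kernel `decide`, no native) `stub_notch54Cert`: on ANY graph `G` on `Site 2` whose adjacency is lattice adjacency inside the 17-site set
`(0,6)×(0,5) ∖ {(3,1),(2,1),(3,2)}`, for every `61/100 ≤ x ≤ 1`: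
`Z_G(W,E_b) + Z_G(W,N_b) < Z_G(W,v)·(Z_G(v,E_b) + Z_G(v,N_b))` with `W = (1,1)`, `v = (2,2)`, `E_b = (4,2)`, `N_b = (3,3)` — exact
path-count polynomials by the sibling's kernel-evaluable enumerator (`Cert.pathCountV`, `Cert.pathKernel_eq_evPolyV`) and a `PolyMP.posOn`
certificate of `R·Q − P` on `[61/100, 1]`. [folklore] -/
theorem stub_notch54Cert : ∀ (G : SimpleGraph (Site 2)) (x : ℝ),
    (∀ p q : Site 2, G.Adj p q ↔ (zdGraph 2).Adj p q ∧
      p ∈ Negative.Rect.box 0 6 0 5 \ {bx 3 1, bx 2 1, bx 3 2} ∧ q ∈ Negative.Rect.box 0 6 0 5 \ {bx 3 1, bx 2 1, bx 3 2}) →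
    (61 / 100 : ℝ) ≤ x → x ≤ 1 →
    pathKernel G x (bx 1 1) (bx 4 2) + pathKernel G x (bx 1 1) (bx 3 3) <
      pathKernel G x (bx 1 1) (bx 2 2) * (pathKernel G x (bx 2 2) (bx 4 2) + pathKernel G x (bx 2 2) (bx 3 3)) :=
  Families.stub_notch54Cert

/-- GLUE (lead): **left–right association fails at every fugacity `61/100 ≤ x ≤ 1`** — a certified supercritical interval. `PA x`
would give the notch three-point inequality on the `5 × 4` notched box (`notchThreePoint_of_PA` road: T9b realisation, T9d up-closed
events, the graded statement at `k = m = 0`, T9c bookkeeping), contradicting the certificate T10. [folklore] -/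
theorem not_PA_of_ge (x : ℝ) (hlo : (61 / 100 : ℝ) ≤ x) (hhi : x ≤ 1) : ¬ PA x := by
  intro hPA
  have hx : 0 < x := lt_of_lt_of_le (by norm_num) hlo
  obtain ⟨C, ha', hs, hdom, hadj⟩ := stub_notchedBoxWalk 0 6 0 5 3 (by norm_num) (by norm_num) (by norm_num)
  obtain ⟨hE, hF⟩ := stub_notchUpClosed 0 6 0 5 3 C (by norm_num) (by norm_num) (by norm_num) hadj
  have hInst : IsInst 1 (bx (3 - 1) (0 + 1)) (bx 3 (0 + 2)) (bx (3 - 1) 0) (bx 3 (0 + 1)) C :=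
    ⟨one_pos, ha', hs, Negative.adj_bx _ _ _ _ (by norm_num), Negative.adj_bx _ _ _ _ (by norm_num)⟩
  have key := hPA 1 (bx 0 0) (bx (3 - 1) (0 + 1)) (bx 3 (0 + 2)) (bx (3 - 1) 0) (bx 3 (0 + 1)) C hInst
    0 (fun _ => bx (3 - 1) (0 + 1)) 0 (fun _ => bx 3 (0 + 2)) Set.univ Set.univ _ _
    (isUpOn_of_isUp hE) (isUpOn_of_isUp hF) (by simp) (by simp)
  simp only [restrP_zero_univ, Set.inter_univ] at key
  have h3 := stub_notchThreePointOfIneq x 0 6 0 5 3 C hx (by norm_num) (by norm_num) (by norm_num) hadj key _ rfl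
  -- the free graph of the instance is the lattice graph on the 17 listed sites
  have hG : ∀ p q : Site 2, (freeGraph (dom C 1) 1 0 (fun _ => bx (3 - 1) (0 + 1)) 0 (fun _ => bx 3 (0 + 2))).Adj p q ↔
      (zdGraph 2).Adj p q ∧ p ∈ Negative.Rect.box 0 6 0 5 \ {bx 3 1, bx 2 1, bx 3 2} ∧
        q ∈ Negative.Rect.box 0 6 0 5 \ {bx 3 1, bx 2 1, bx 3 2} := by
    intro p q
    rw [freeGraph_adj, hadj]
    have hfix : ∀ w : Site 2, w ∈ fixedSet 0 (fun _ => bx (3 - 1) (0 + 1)) 0 (fun _ => bx 3 (0 + 2)) ↔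
        w = bx 2 1 ∨ w = bx 3 2 := by
      intro w
      simp only [fixedSet, Set.mem_setOf_eq, Nat.le_zero, exists_eq_left]
      constructor
      · rintro (h | h) <;> [left; right] <;> rw [← h] <;> rfl
      · rintro (rfl | rfl) <;> [left; right] <;> rfl
    simp only [hfix, Set.mem_sdiff, Set.mem_insert_iff, Set.mem_singleton_iff, not_or]
    tauto
  have hcert := stub_notch54Cert _ x hG hlo hhi
  have e1 : bx (3 - 2) (0 + 1) = bx 1 1 := rfl
  have e2 : bx (3 - 1) (0 + 2) = bx 2 2 := rfl
  have e3 : bx (3 + 1) (0 + 2) = bx 4 2 := rfl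
  have e4 : bx 3 (0 + 3) = bx 3 3 := rfl
  rw [e1, e2, e3, e4] at h3
  exact absurd h3 (not_le.2 hcert)

/-! ### Pushing the certified supercritical edge to `0.52` (v9i): the `6 × 5` bottom-corner minor

`stub_cornerMinorOfIneq` is the fugacity-free refactor of T8 (up-closedness of the two corner events + bookkeeping from ONE inequality of
`μx x`), `stub_corner65Cert` the graph-level certificate that on the `6 × 5` box with the two bottom corners deleted the CROSSED product
beats the nested one for all `13/25 ≤ x ≤ 1` (exact enumeration: 443 473 paths from `u₁ = (2,1)`; root of crossed − nested in
`(0.50, 0.51)`), and `not_PA_of_ge_052` the glue: `¬ PA x` for every `0.52 ≤ x ≤ 1`.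
-/

/-- STUB T11 (M) — LANDED (p162914, `…CornerMinorOfIneq.lean`, worker) `stub_cornerMinorOfIneq`: on a box realised abstractly (`Ω_1` = lattice adjacency inside the open box), with the marked
points at the bottom corners `a = (x₀+1,y₀+1)`, `b = (x₁-1,y₀+1)`: (i) `{first step North}` and `{last step from the North}` are
`≼`-up-closed (T2 at the corners); (ii) for every `0 < x`, the ONE inequality `μ(E)μ(F) ≤ μ(univ)μ(E ∩ F)` of `μx x` for these events is
equivalent (class dictionary at `k = m = 0`) to the TP₂ corner minor `Z_G(u₂,w₁)Z_G(u₁,w₂) ≤ Z_G(u₁,w₁)Z_G(u₂,w₂)` of the fugacity-`x`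
kernel of the free graph. (Fugacity-free refactor of `stub_boxCornerMinor`.) [folklore] -/
theorem stub_cornerMinorOfIneq : ∀ (x : ℝ) (x₀ x₁ y₀ y₁ : ℤ) (C : (zdGraph 2).Walk (bx x₀ y₀) (bx x₀ y₀)),
    0 < x → x₀ + 4 ≤ x₁ → y₀ + 2 < y₁ →
    (∀ u w : Site 2, (discreteDomainGraph (dom C 1) 1).Adj u w ↔
      (zdGraph 2).Adj u w ∧ u ∈ Negative.Rect.box x₀ x₁ y₀ y₁ ∧ w ∈ Negative.Rect.box x₀ x₁ y₀ y₁) →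
    (IsUp ({γ | γ.walk.getVert 1 = bx (x₀ + 1) (y₀ + 2)} :
        Set (SAW.DomainSAW (dom C 1) 1 (bx (x₀ + 1) (y₀ + 1)) (bx (x₁ - 1) (y₀ + 1)))) ∧
      IsUp ({γ | γ.walk.reverse.getVert 1 = bx (x₁ - 1) (y₀ + 2)} :
        Set (SAW.DomainSAW (dom C 1) 1 (bx (x₀ + 1) (y₀ + 1)) (bx (x₁ - 1) (y₀ + 1))))) ∧
    (μx x (dom C 1) 1 (bx (x₀ + 1) (y₀ + 1)) (bx (x₁ - 1) (y₀ + 1)) {γ | γ.walk.getVert 1 = bx (x₀ + 1) (y₀ + 2)} *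
        μx x (dom C 1) 1 (bx (x₀ + 1) (y₀ + 1)) (bx (x₁ - 1) (y₀ + 1)) {γ | γ.walk.reverse.getVert 1 = bx (x₁ - 1) (y₀ + 2)} ≤
      μx x (dom C 1) 1 (bx (x₀ + 1) (y₀ + 1)) (bx (x₁ - 1) (y₀ + 1)) Set.univ *
        μx x (dom C 1) 1 (bx (x₀ + 1) (y₀ + 1)) (bx (x₁ - 1) (y₀ + 1))
          ({γ | γ.walk.getVert 1 = bx (x₀ + 1) (y₀ + 2)} ∩ {γ | γ.walk.reverse.getVert 1 = bx (x₁ - 1) (y₀ + 2)}) →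
      ∀ G : SimpleGraph (Site 2),
        G = freeGraph (dom C 1) 1 0 (fun _ => bx (x₀ + 1) (y₀ + 1)) 0 (fun _ => bx (x₁ - 1) (y₀ + 1)) →
        pathKernel G x (bx (x₀ + 1) (y₀ + 2)) (bx (x₁ - 2) (y₀ + 1)) * pathKernel G x (bx (x₀ + 2) (y₀ + 1)) (bx (x₁ - 1) (y₀ + 2)) ≤
          pathKernel G x (bx (x₀ + 2) (y₀ + 1)) (bx (x₁ - 2) (y₀ + 1)) * pathKernel G x (bx (x₀ + 1) (y₀ + 2)) (bx (x₁ - 1) (y₀ + 2))) :=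
  Families.stub_cornerMinorOfIneq

/-- STUB T12 (M) — LANDED (p165502, `…Corner65Cert.lean`, worker; native_decide, --computational) `stub_corner65Cert`: on ANY graph whose adjacency is lattice adjacency inside the `6 × 5` box
`(0,7)×(0,6)` minus its two bottom corners `(1,1), (6,1)`, for every `13/25 ≤ x ≤ 1` the crossed product is STRICTLY larger:
`Z(u₁,w₁)·Z(u₂,w₂) < Z(u₂,w₁)·Z(u₁,w₂)` with `u₁ = (2,1)`, `u₂ = (1,2)`, `w₁ = (5,1)`, `w₂ = (6,2)` (exact path-count polynomials,
`Cert.pathKernel_eq_evPolyV`; crossed − nested `= −x⁸ − 11x¹⁰ − 66x¹² − 267x¹⁴ − 316x¹⁶ + 2972x¹⁸ + …`, root in `(0.50, 0.51)`;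
`PolyMP.posOn` on `[13/25, 1]`). [folklore] -/
theorem stub_corner65Cert : ∀ (G : SimpleGraph (Site 2)) (x : ℝ),
    (∀ p q : Site 2, G.Adj p q ↔ (zdGraph 2).Adj p q ∧
      p ∈ Negative.Rect.box 0 7 0 6 \ {bx 1 1, bx 6 1} ∧ q ∈ Negative.Rect.box 0 7 0 6 \ {bx 1 1, bx 6 1}) →
    (13 / 25 : ℝ) ≤ x → x ≤ 1 →
    pathKernel G x (bx 2 1) (bx 5 1) * pathKernel G x (bx 1 2) (bx 6 2) <
      pathKernel G x (bx 1 2) (bx 5 1) * pathKernel G x (bx 2 1) (bx 6 2) :=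
  Families.stub_corner65Cert

/-- GLUE (lead): **left–right association fails at every fugacity `13/25 ≤ x ≤ 1`.** On the `6 × 5` box (T1 realisation,
`Rect.dAdj_iff`) `PA x` would give the corner minor (T11), against the certificate T12. [folklore] -/
theorem not_PA_of_ge_052 (x : ℝ) (hlo : (13 / 25 : ℝ) ≤ x) (hhi : x ≤ 1) : ¬ PA x := by
  intro hPA
  have hx : 0 < x := lt_of_lt_of_le (by norm_num) hlo
  obtain ⟨C, hb, hch, hcomp, hcross⟩ := stub_rectBoundaryWalk 0 7 0 6 (by norm_num) (by norm_num)
  have hface : (0 : ℤ) ≤ 0 ∧ (0 : ℤ) + 1 ≤ 7 ∧ (0 : ℤ) ≤ 0 ∧ (0 : ℤ) + 1 ≤ 6 := by norm_num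
  have hcross' : pathCross 0 0 (bx 0 0) C.support.tail ≠ 0 := by rw [hcross]; decide
  have hdom : dom C 1 = Negative.Rect.Ω C := rfl
  have hadj : ∀ u w : Site 2, (discreteDomainGraph (dom C 1) 1).Adj u w ↔
      (zdGraph 2).Adj u w ∧ u ∈ Negative.Rect.box 0 7 0 6 ∧ w ∈ Negative.Rect.box 0 7 0 6 := fun u w => by
    rw [hdom]; exact Negative.Rect.dAdj_iff hb hch hcomp hface hcross'
  obtain ⟨⟨hE, hF⟩, hbook⟩ := stub_cornerMinorOfIneq x 0 7 0 6 C hx (by norm_num) (by norm_num) hadj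
  have hInst : IsInst 1 (bx (0 + 1) (0 + 1)) (bx (7 - 1) (0 + 1)) (bx (0 + 1) 0) (bx (7 - 1) 0) C :=
    ⟨one_pos, hcomp _ _ (by norm_num) (by norm_num) le_rfl (by norm_num) (Or.inr (Or.inr (Or.inl rfl))),
      hcomp _ _ (by norm_num) (by norm_num) le_rfl (by norm_num) (Or.inr (Or.inr (Or.inl rfl))),
      Negative.adj_bx _ _ _ _ (by norm_num), Negative.adj_bx _ _ _ _ (by norm_num)⟩
  have key := hPA 1 (bx 0 0) (bx (0 + 1) (0 + 1)) (bx (7 - 1) (0 + 1)) (bx (0 + 1) 0) (bx (7 - 1) 0) C hInst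
    0 (fun _ => bx (0 + 1) (0 + 1)) 0 (fun _ => bx (7 - 1) (0 + 1)) Set.univ Set.univ _ _
    (isUpOn_of_isUp hE) (isUpOn_of_isUp hF) (by simp) (by simp)
  simp only [restrP_zero_univ, Set.inter_univ] at key
  have hmin := hbook key _ rfl
  have hG : ∀ p q : Site 2, (freeGraph (dom C 1) 1 0 (fun _ => bx (0 + 1) (0 + 1)) 0 (fun _ => bx (7 - 1) (0 + 1))).Adj p q ↔
      (zdGraph 2).Adj p q ∧ p ∈ Negative.Rect.box 0 7 0 6 \ {bx 1 1, bx 6 1} ∧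
        q ∈ Negative.Rect.box 0 7 0 6 \ {bx 1 1, bx 6 1} := by
    intro p q
    rw [freeGraph_adj, hadj]
    have hfix : ∀ w : Site 2, w ∈ fixedSet 0 (fun _ => bx (0 + 1) (0 + 1)) 0 (fun _ => bx (7 - 1) (0 + 1)) ↔
        w = bx 1 1 ∨ w = bx 6 1 := by
      intro w
      simp only [fixedSet, Set.mem_setOf_eq, Nat.le_zero, exists_eq_left]
      constructor
      · rintro (h | h) <;> [left; right] <;> rw [← h] <;> rfl
      · rintro (rfl | rfl) <;> [left; right] <;> rfl
    simp only [hfix, Set.mem_sdiff, Set.mem_insert_iff, Set.mem_singleton_iff, not_or]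
    tauto
  have hcert := stub_corner65Cert _ x hG hlo hhi
  have e1 : bx (0 + 1) (0 + 2) = bx 1 2 := rfl
  have e2 : bx (7 - 2) (0 + 1) = bx 5 1 := rfl
  have e3 : bx (0 + 2) (0 + 1) = bx 2 1 := rfl
  have e4 : bx (7 - 1) (0 + 2) = bx 6 2 := rfl
  rw [e1, e2, e3, e4] at hmin
  exact absurd hmin (not_le.2 hcert)

/-! ### Assembly of the ladder family (lead, kernel-checked modulo T1/T3/T4) -/

/-- THE LADDER FAMILY: for every `L`, the rectangle walk of T1 around `[-1, L+1] × [-1, 2]` realises the ladder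
`{0..L} × {0,1}` as a crux domain `dom C 1` (with `(0,-1), (L,-1)` on the boundary walk, so that `((0,0), (L,0))` is an
honest pair of marked points), and the chord measure `μx x` between the bottom corners is positively associated in the
crux's event form at EVERY fugacity `0 ≤ x ≤ 1` (T4 + T3). [folklore] -/
theorem ladderPA (L : ℕ) : ∃ C : (zdGraph 2).Walk (bx (-1) (-1)) (bx (-1) (-1)),
    bx 0 (-1) ∈ C.support ∧ bx L (-1) ∈ C.support ∧
    meshDomain (dom C 1) 1 = Negative.Rect.box (-1) (L + 1) (-1) 2 ∧
    ∀ x : ℝ, 0 ≤ x → x ≤ 1 → ∀ A B : Set (SAW.DomainSAW (dom C 1) 1 (bx 0 0) (bx L 0)), IsUp A → IsUp B →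
      μx x (dom C 1) 1 (bx 0 0) (bx L 0) A * μx x (dom C 1) 1 (bx 0 0) (bx L 0) B ≤
        μx x (dom C 1) 1 (bx 0 0) (bx L 0) Set.univ * μx x (dom C 1) 1 (bx 0 0) (bx L 0) (A ∩ B) := by
  obtain ⟨C, hb, hch, hcomp, hcross⟩ :=
    stub_rectBoundaryWalk (-1) (L + 1) (-1) 2 (by omega) (by omega)
  have hface : (-1 : ℤ) ≤ -1 ∧ (-1 : ℤ) + 1 ≤ L + 1 ∧ (-1 : ℤ) ≤ -1 ∧ (-1 : ℤ) + 1 ≤ 2 := by omega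
  have hcross' : pathCross (-1) (-1) (bx (-1) (-1)) C.support.tail ≠ 0 := by rw [hcross]; decide
  have hdom : dom C 1 = Negative.Rect.Ω C := rfl
  refine ⟨C, hcomp 0 (-1) (by omega) (by omega) le_rfl (by omega) (Or.inr (Or.inr (Or.inl rfl))),
    hcomp L (-1) (by omega) (by omega) le_rfl (by omega) (Or.inr (Or.inr (Or.inl rfl))), ?_, ?_⟩
  · rw [hdom]; exact Negative.Rect.meshDomain_Ω hb hch hcomp hface hcross'
  · intro x hx0 hx1 A B hA hB
    have hadj : ∀ u v : Site 2, (discreteDomainGraph (dom C 1) 1).Adj u v ↔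
        (zdGraph 2).Adj u v ∧ u ∈ Negative.Rect.box (-1) (L + 1) (-1) 2 ∧
          v ∈ Negative.Rect.box (-1) (L + 1) (-1) 2 := fun u v => by
      rw [hdom]; exact Negative.Rect.dAdj_iff hb hch hcomp hface hcross'
    have key := ladderChords L (dom C 1) hadj
    simp only at key
    obtain ⟨hbij, hmono, hsub⟩ := key
    haveI : Fintype (SAW.DomainSAW (dom C 1) 1 (bx 0 0) (bx L 0)) := Fintype.ofInjective _ hbij.1
    exact stub_fkgTransfer (dom C 1) 1 (bx 0 0) (bx L 0) (Fin L → Bool) _ hbij hmono hsub x hx0 hx1 A B hA hB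

/-- The ladder family IN THE CRUX'S OWN SHAPE: honest instances `(1, C, (0,0), (L,0), (0,-1), (L,-1))` (`IsInst`) whose
critical chord measure `SAW.weight = μx x_c` is positively associated for `≼`-up-closed events. [folklore] -/
theorem ladder_leftRightFKG (L : ℕ) : ∃ C : (zdGraph 2).Walk (bx (-1) (-1)) (bx (-1) (-1)),
    IsInst 1 (bx 0 0) (bx L 0) (bx 0 (-1)) (bx L (-1)) C ∧
    meshDomain (dom C 1) 1 = Negative.Rect.box (-1) (L + 1) (-1) 2 ∧
    ∀ A B : Set (SAW.DomainSAW (dom C 1) 1 (bx 0 0) (bx L 0)), IsUp A → IsUp B →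
      SAW.weight (dom C 1) 1 (bx 0 0) (bx L 0) A * SAW.weight (dom C 1) 1 (bx 0 0) (bx L 0) B ≤
        SAW.weight (dom C 1) 1 (bx 0 0) (bx L 0) Set.univ * SAW.weight (dom C 1) 1 (bx 0 0) (bx L 0) (A ∩ B) := by
  obtain ⟨C, ha', hb', hdom, hPA⟩ := ladderPA L
  refine ⟨C, ⟨one_pos, ha', hb', ?_, ?_⟩, hdom, fun A B hA hB => ?_⟩
  · exact Negative.adj_bx 0 0 0 (-1) (by omega)
  · exact Negative.adj_bx L 0 L (-1) (by omega)
  · simpa only [weight_eq_μx] using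
      hPA SAW.criticalFugacity SAW.criticalFugacity_pos_lt_one'.1.le SAW.criticalFugacity_pos_lt_one'.2.le A B hA hB

end ToolsC4

end Summit.CriticalPhenomena.SAWScalingLimit.Cruxes.LeftRightFKG.CornerLocalisation

end
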